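import Summits.CriticalPhenomena.SAWScalingLimit.Theorems.SAWRenewalTightnessSubseqIdentificationCompensatorVerticalSlit
import Literature.Probability.RandomPlanarGeometry.LoewnerSlidHullStar
import HarnessLib

/-!
# Steering data, vertical case (line `boundary-area-law`, L3a-V)

Line `boundary-area-law` of the crux `SubseqIdentification` (stmt-CriticalPhenomena-0783), lead c5's
reshape, stub `stub_steeringVertical`: the deterministic "exact steering data" in the VERTICAL case.
The zero driving function `U ≡ 0` generates the vertical slit `(0, 2i√t]`; its Loewner map is
`g_t(z) = √(z² + 4t)`, and for the lowest point `i y₀` of a `*`-hull `A` on the imaginary axis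
`g_s(i y₀) = i√(y₀² − 4s)` for `4s < y₀²` (`map_zeroDriver_I_mul`, lead c4's file
`…CompensatorVerticalSlit`). Hence the certified integrand `(Im Z_s/|Z_s|²)²/2` of the point
`Z_s = g_s(i y₀)` equals `1/(2(y₀² − 4s))` (`integrand_zeroDriver_I_mul_eq_c5`), and
`∫_{(0,S]} ds/(2(y₀² − 4s)) = (1/8) log (y₀²/(y₀² − 4S))`
(`log_div_le_lintegral_integrand_zeroDriver_c5`, the FTC computation of c4's
`log_div_le_lintegral_starBubbleMass_zeroDriver` with the pointwise mass bound replaced by the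
pointwise identity), which is `≥ q` for `4S = y₀²(1 − e^{−8 max(q,0)})`. At such a time `S` every
point of `A` is still flowing (`disjoint_closedHull_zeroDriver` and
`Loewner.lt_swallowingTime_of_disjoint_closedHull`).

References: G. F. Lawler, *Conformally Invariant Processes in the Plane* (2005), Ch. 4 §4.1 (the
vertical slit example). No named fact is used.
-/

noncomputable section

open MeasureTheory Filter Topology Set Metric
open scoped NNReal ENNReal
open Literature.Probability.RandomPlanarGeometry
open UpperHalfPlane (upperHalfPlaneSet)

namespace Summit.CriticalPhenomena.SAWScalingLimit.Theorems.SubseqIdentification.BoundaryAreaLaw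

open Loewner

section SteeringVertical

variable {y₀ : ℝ}

/-- **The certified integrand along the vertical slit.** For `y₀ > 0` and `4t < y₀²`, the point
`Z_t = g_t(i y₀) = i√(y₀² − 4t)` of the zero driver has `(Im Z_t/|Z_t|²)²/2 = 1/(2(y₀² − 4t))`.
[cite: Lawler2005, Ch. 4 §4.1] -/
theorem integrand_zeroDriver_I_mul_eq_c5 (hy₀ : 0 < y₀) {t : ℝ≥0} (ht : 4 * (t : ℝ) < y₀ ^ 2) :
    ((map (fun _ : ℝ≥0 ↦ (0 : ℝ)) t (Complex.I * y₀)).im /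
        Complex.normSq (map (fun _ : ℝ≥0 ↦ (0 : ℝ)) t (Complex.I * y₀))) ^ 2 / 2 =
      1 / (2 * (y₀ ^ 2 - 4 * t)) := by
  rw [map_zeroDriver_I_mul hy₀ ht]
  set r : ℝ := y₀ ^ 2 - 4 * t with hr
  have hrpos : 0 < r := by rw [hr]; linarith
  have him : (Complex.I * Real.sqrt r).im = Real.sqrt r := by simp
  have hns : Complex.normSq (Complex.I * Real.sqrt r) = r := by
    rw [Complex.normSq_mul, Complex.normSq_I, one_mul, Complex.normSq_ofReal,
      Real.mul_self_sqrt hrpos.le]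
  rw [him, hns, div_pow, Real.sq_sqrt hrpos.le]
  field_simp

/-- **Integrating the certified integrand along the vertical slit**: for `y₀ > 0` and `4T < y₀²`,
`(1/8) log (y₀²/(y₀² − 4T)) ≤ ∫_{(0,T]} (Im Z_s/|Z_s|²)²/2 ds` (`Z_s = g_s(i y₀)`, zero driver;
in fact an equality), by the fundamental theorem of calculus for `s ↦ −log(y₀² − 4s)/8`.
[cite: Lawler2005, Ch. 4 §4.1] -/
theorem log_div_le_lintegral_integrand_zeroDriver_c5 (hy₀ : 0 < y₀) {T : ℝ≥0}
    (hT : 4 * (T : ℝ) < y₀ ^ 2) :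
    ENNReal.ofReal (Real.log (y₀ ^ 2 / (y₀ ^ 2 - 4 * T)) / 8) ≤
      ∫⁻ x in Ioc (0 : ℝ) T,
        ENNReal.ofReal (((map (fun _ : ℝ≥0 ↦ (0 : ℝ)) x.toNNReal (Complex.I * y₀)).im /
          Complex.normSq (map (fun _ : ℝ≥0 ↦ (0 : ℝ)) x.toNNReal (Complex.I * y₀))) ^ 2 / 2) := by
  set f : ℝ → ℝ := fun x ↦ 1 / (2 * (y₀ ^ 2 - 4 * x)) with hf
  set F : ℝ → ℝ := fun x ↦ -(Real.log (y₀ ^ 2 - 4 * x)) / 8 with hF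
  have hT0 : (0 : ℝ) ≤ T := T.coe_nonneg
  have hpos : ∀ x ∈ Icc (0 : ℝ) T, 0 < y₀ ^ 2 - 4 * x := fun x hx ↦ by linarith [hx.2]
  -- FTC: `∫₀^T f = F T − F 0`
  have hderiv : ∀ x ∈ uIcc (0 : ℝ) T, HasDerivAt F (f x) x := by
    intro x hx
    rw [uIcc_of_le hT0] at hx
    have h1 : HasDerivAt (fun x : ℝ ↦ y₀ ^ 2 - 4 * x) (-4) x := by
      simpa using ((hasDerivAt_id x).const_mul (4 : ℝ)).const_sub (y₀ ^ 2)
    have h2 := ((h1.log (hpos x hx).ne').neg).div_const 8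
    refine h2.congr_deriv ?_
    rw [hf]
    field_simp [(hpos x hx).ne']
    ring
  have hfc : ContinuousOn f (Icc (0 : ℝ) T) := by
    refine continuousOn_const.div (continuousOn_const.mul (continuousOn_const.sub
      (continuousOn_const.mul continuousOn_id))) fun x hx ↦ ?_
    exact mul_ne_zero two_ne_zero (hpos x hx).ne'
  have hfi : IntervalIntegrable f volume 0 T := hfc.intervalIntegrable_of_Icc hT0
  have hFTC : ∫ x in (0 : ℝ)..T, f x = Real.log (y₀ ^ 2 / (y₀ ^ 2 - 4 * T)) / 8 := by
    rw [intervalIntegral.integral_eq_sub_of_hasDerivAt hderiv hfi, hF]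
    simp only [mul_zero, sub_zero]
    rw [Real.log_div (by positivity) (hpos T ⟨hT0, le_rfl⟩).ne']
    ring
  -- pointwise identity on `(0, T]`
  have hpt : ∀ x ∈ Ioc (0 : ℝ) T,
      ENNReal.ofReal (f x) ≤
        ENNReal.ofReal (((map (fun _ : ℝ≥0 ↦ (0 : ℝ)) x.toNNReal (Complex.I * y₀)).im /
          Complex.normSq (map (fun _ : ℝ≥0 ↦ (0 : ℝ)) x.toNNReal (Complex.I * y₀))) ^ 2 / 2) := by
    intro x hx
    refine ENNReal.ofReal_le_ofReal (le_of_eq ?_)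
    have hx' : ((x.toNNReal : ℝ≥0) : ℝ) = x := Real.coe_toNNReal _ hx.1.le
    have key := integrand_zeroDriver_I_mul_eq_c5 hy₀ (t := x.toNNReal)
      (by rw [hx']; linarith [hx.2])
    rw [hx'] at key
    exact key.symm
  have hnn : 0 ≤ᵐ[volume.restrict (Ioc (0 : ℝ) T)] f := by
    filter_upwards [ae_restrict_mem measurableSet_Ioc] with x hx
    exact (one_div_pos.2 (mul_pos two_pos (hpos x (Ioc_subset_Icc_self hx)))).le
  calc ENNReal.ofReal (Real.log (y₀ ^ 2 / (y₀ ^ 2 - 4 * T)) / 8)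
      = ENNReal.ofReal (∫ x in (0 : ℝ)..T, f x) := by rw [hFTC]
    _ = ∫⁻ x in Ioc (0 : ℝ) T, ENNReal.ofReal (f x) := by
        rw [intervalIntegral.integral_of_le hT0,
          ofReal_integral_eq_lintegral_ofReal
            ((intervalIntegrable_iff_integrableOn_Ioc_of_le hT0).1 hfi) hnn]
    _ ≤ ∫⁻ x in Ioc (0 : ℝ) T,
        ENNReal.ofReal (((map (fun _ : ℝ≥0 ↦ (0 : ℝ)) x.toNNReal (Complex.I * y₀)).im /
          Complex.normSq (map (fun _ : ℝ≥0 ↦ (0 : ℝ)) x.toNNReal (Complex.I * y₀))) ^ 2 / 2) :=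
        setLIntegral_mono' measurableSet_Ioc hpt

end SteeringVertical

/-! ### Registered form -/

/-- **L3a-V — STEERING DATA, VERTICAL CASE (registered stub `stub_steeringVertical`).** For
`A ∈ 𝒬*` whose lowest point on the imaginary axis is `i y₀` (`y₀ > 0`): for every `q` there is a
time `S` (`4S = y₀²(1 − e^{−8 max(q,0)}) < y₀²`) such that every point of `A` (real points included)
is still flowing at `S` under the zero driver (`disjoint_closedHull_zeroDriver`,
`Loewner.lt_swallowingTime_of_disjoint_closedHull`), and the certified integrand of the point
`i y₀`, `(Im Z_s/|Z_s|²)²/2 = 1/(2(y₀² − 4s))` with `Z_s = g_s(i y₀) = i√(y₀² − 4s)`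
(`map_zeroDriver_I_mul`), has `∫_{(0,S]} ≥ (1/8) log (y₀²/(y₀² − 4S)) = max(q,0) ≥ q`.
[cite: Lawler2005, Ch. 4 §4.1 (vertical slit)] -/
theorem stub_steeringVertical :
    ∀ (A : Set ℂ), IsStarHull A → ∀ (y₀ : ℝ), 0 < y₀ → Complex.I * y₀ ∈ A →
      (∀ y : ℝ, 0 < y → y < y₀ → Complex.I * y ∉ A) → ∀ (q : ℝ),
      ∃ S : ℝ≥0, (∀ z ∈ A, (S : WithTop ℝ≥0) < Loewner.swallowingTime (fun _ : ℝ≥0 => (0 : ℝ)) z) ∧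
        ENNReal.ofReal q ≤ ∫⁻ s in Set.Ioc (0 : ℝ) S,
          ENNReal.ofReal (((Loewner.map (fun _ : ℝ≥0 => (0 : ℝ)) s.toNNReal (Complex.I * y₀)).im /
            Complex.normSq (Loewner.map (fun _ : ℝ≥0 => (0 : ℝ)) s.toNNReal (Complex.I * y₀))) ^ 2 / 2) := by
  intro A hA y₀ hy₀ _hmem hgap q
  -- `Q = max q 0 ≥ 0`, and the steering time `4S = y₀² (1 − e^{−8Q})`
  obtain ⟨Q, hqQ, hQ0⟩ : ∃ Q : ℝ, q ≤ Q ∧ 0 ≤ Q := ⟨max q 0, le_max_left _ _, le_max_right _ _⟩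
  have hexp1 : Real.exp (-(8 * Q)) ≤ 1 := Real.exp_le_one_iff.2 (by linarith)
  have hs0 : 0 ≤ y₀ ^ 2 / 4 * (1 - Real.exp (-(8 * Q))) :=
    mul_nonneg (by positivity) (sub_nonneg.2 hexp1)
  obtain ⟨S, hS⟩ : ∃ S : ℝ≥0, (S : ℝ) = y₀ ^ 2 / 4 * (1 - Real.exp (-(8 * Q))) := ⟨⟨_, hs0⟩, rfl⟩
  have h4S : y₀ ^ 2 - 4 * (S : ℝ) = y₀ ^ 2 * Real.exp (-(8 * Q)) := by rw [hS]; ring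
  have hSlt : 4 * (S : ℝ) < y₀ ^ 2 := by
    have : 0 < y₀ ^ 2 * Real.exp (-(8 * Q)) := by positivity
    linarith
  refine ⟨S, fun z hz ↦ ?_, ?_⟩
  · -- every point of `A` is still flowing at `S`: the closed hull of the slit misses `A`
    exact Loewner.lt_swallowingTime_of_disjoint_closedHull hA.isBoundedHull.subset_closure
      (disjoint_closedHull_zeroDriver hA hy₀ hgap hSlt) hz
  · -- `(1/8) log (y₀²/(y₀² − 4S)) = Q ≥ q`
    have hlog : Real.log (y₀ ^ 2 / (y₀ ^ 2 - 4 * S)) / 8 = Q := by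
      rw [h4S, Real.exp_neg, div_mul_eq_div_div, div_self (pow_pos hy₀ 2).ne', div_inv_eq_mul,
        one_mul, Real.log_exp]
      ring
    calc ENNReal.ofReal q ≤ ENNReal.ofReal Q := ENNReal.ofReal_le_ofReal hqQ
      _ = ENNReal.ofReal (Real.log (y₀ ^ 2 / (y₀ ^ 2 - 4 * S)) / 8) := by rw [hlog]
      _ ≤ _ := log_div_le_lintegral_integrand_zeroDriver_c5 hy₀ hSlt

end Summit.CriticalPhenomena.SAWScalingLimit.Theorems.SubseqIdentification.BoundaryAreaLaw

end
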